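import Mathlib
import Summits.QuantumFields.BalabanUV.Beta.UnitLatticeWalkInversionDecay

/-!
# `Summit.QuantumFields.BalabanUV.Beta.UnitLatticeNearFar` — A3-loc (ii): NEAR∕FAR splitting of a local inverse —
# `(A_near + F)⁻¹ = Σ_{k<p} (−A_near⁻¹F)^k A_near⁻¹ + (−A_near⁻¹F)^p (1 + A_near⁻¹F)⁻¹ A_near⁻¹` on a cube, with budgets
# `≤ (C_nφ)^k C_n` per order and `≤ (C_nφ)^p (1 − C_nφ)⁻¹ C_n` for the remainder, and the `extend` algebra that carries
# it to the unit lattice; the leading term `A_near⁻¹` sees ONLY the near part (U-locality of the local inverses)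

HONEST FRAMING (page 1 of everything in this cell).  Discharging `FlowStep.BetaPertH` would make
Bałaban's ultraviolet stability UNCONDITIONAL — a constructive-QFT result; it is NOT the continuum
limit and NOT the Clay problem.  This module discharges nothing of `BetaPertH`; [folklore] algebra,
kernel-checked (unit `b2b-balaban-beta-d4-p3`, road P3 «reduction road», gen 3; leaf A3-loc (ii) of skeleton v1.7 §7.4 =
the owner's rider (ρ3), first half «near∕far U-localisation of the local inverses»).
HONEST DEPENDENCY: continuum YM on T⁴ ⇐ BetaPertH ∧ nine spine estimates (0/9 proved); BetaPertH ⇐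
(D1) ∧ (D4) ∧ CAP+tail; G-an2-4 gates asym, D1 and NE2/3/4.

WHY.  In the unit-lattice walk inversion the local inverse `L_□ = extend((compress (1 + K′) □̃)⁻¹)` depends on `K′`
restricted to `□̃ × □̃`, hence — when `K′ = Σ_ω K_ω` is itself a walk sum — on EVERY walk `ω` touching `□̃`, however
far it reaches.  Splitting `K′ = K_near + K_far` (near = the walks contained in a fixed neighbourhood `N(□)`; far = the
rest, small by their decay) and expanding the compressed inverse in the far part gives terms whose leading factor
`(compress (1 + K_near) □̃)⁻¹` is a function of the NEAR family only, the far pieces appearing as explicit factors —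
the U-localisation of [II] (1.10) ∕ (2.10) for the resolvent's local inverses.  Abstract over the split.
CONTENTS (0 sorry): §1 `extend_add`, `extend_mul`, `extend_neg`, `compress_add` (the extension by zero is additive and
MULTIPLICATIVE on cube-supported kernels); §2 `inv_near_add_far_eq_sum` (the order-`p` expansion, from
`B13PerturbativeStep.inv_add_eq` + this road's `UnitLatticeWalkInversion.inv_one_sub_eq_sum_add`), `wrs_nearFar_term`
(order-`k` term `≤ (C_nφ)^k·C_n`), `wrs_nearFar_remainder` (`≤ (C_nφ)^p·(1 − C_nφ)⁻¹·C_n`), `isUnit_near_add_far`;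
§3 `locInv_split` — the unit-lattice statement for `locInv (K_near + K_far) E b`.  NOT HERE: the word expansion of
`F = Σ_{ω far} compress K_ω` (noncommutative `sum_pow`), the decoration bookkeeping (A3-loc (iii)(iv)); any instance.
-/

open scoped BigOperators Matrix
open Finset Matrix

namespace Summit.QuantumFields.BalabanUV.Beta.UnitLatticeNearFar

open Summit.QuantumFields.BalabanUV.Beta.UnitLatticeWalkInversion
open Summit.QuantumFields.BalabanUV.Beta.UnitLatticeLocalInverse
open Summit.QuantumFields.BalabanUV.Beta.UnitLatticeWalkInversionDecay (locInv)
open Literature.MathematicalPhysics.QuantumFieldTheory.Balaban1983to89.B13PerturbativeStep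

noncomputable section

variable {Y : Type*} [Fintype Y] [DecidableEq Y]

/-! ## §1 The extension by zero is additive and multiplicative -/

omit [Fintype Y] in
/-- `extend (M + N) = extend M + extend N`. [folklore] -/
theorem extend_add {S : Finset Y} (M N : Matrix S S ℂ) : extend (M + N) = extend M + extend N := by
  ext i j
  by_cases hi : i ∈ S
  · by_cases hj : j ∈ S
    · simp [extend_apply_of_mem _ hi hj]
    · simp [extend_apply_of_not_mem_right _ i hj]
  · simp [extend_apply_of_not_mem_left _ hi]

omit [Fintype Y] in
/-- `extend (−M) = −extend M`. [folklore] -/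
theorem extend_neg {S : Finset Y} (M : Matrix S S ℂ) : extend (-M) = -extend M := by
  ext i j
  by_cases hi : i ∈ S
  · by_cases hj : j ∈ S
    · simp [extend_apply_of_mem _ hi hj]
    · simp [extend_apply_of_not_mem_right _ i hj]
  · simp [extend_apply_of_not_mem_left _ hi]

omit [Fintype Y] in
/-- `extend 0 = 0`. [folklore] -/
theorem extend_zero {S : Finset Y} : extend (0 : Matrix S S ℂ) = 0 := by
  ext i j
  by_cases hi : i ∈ S
  · by_cases hj : j ∈ S
    · simp [extend_apply_of_mem _ hi hj]
    · simp [extend_apply_of_not_mem_right _ i hj]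
  · simp [extend_apply_of_not_mem_left _ hi]

omit [Fintype Y] in
/-- `extend` of a finite sum is the sum of the extensions. [folklore] -/
theorem extend_sum {S : Finset Y} {ι : Type*} (s : Finset ι) (f : ι → Matrix S S ℂ) :
    extend (∑ c ∈ s, f c) = ∑ c ∈ s, extend (f c) := by
  classical
  induction s using Finset.induction_on with
  | empty => simp [extend_zero]
  | insert a s ha ih => rw [Finset.sum_insert ha, Finset.sum_insert ha, extend_add, ih]

/-- `extend (M·N) = extend M · extend N` (the sum over the unit lattice reduces to the cube). [folklore] -/
theorem extend_mul {S : Finset Y} (M N : Matrix S S ℂ) : extend (M * N) = extend M * extend N := by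
  ext i j
  rw [Matrix.mul_apply]
  by_cases hi : i ∈ S
  · by_cases hj : j ∈ S
    · rw [extend_apply_of_mem _ hi hj, Matrix.mul_apply,
        sum_eq_sum_subtype_of_support S _ (fun k hk => by rw [extend_apply_of_not_mem_right _ i hk, zero_mul])]
      refine Finset.sum_congr rfl fun k _ => ?_
      rw [extend_apply_of_mem _ hi k.2, extend_apply_of_mem _ k.2 hj]
    · rw [extend_apply_of_not_mem_right _ i hj]
      exact (Finset.sum_eq_zero fun k _ => by rw [extend_apply_of_not_mem_right _ k hj, mul_zero]).symm
  · rw [extend_apply_of_not_mem_left _ hi]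
    exact (Finset.sum_eq_zero fun k _ => by rw [extend_apply_of_not_mem_left _ hi, zero_mul]).symm

/-- `extend (M^k) = (extend M)^k` for `k ≥ 1`; at `k = 0` the extension of `1` is the cube projection, so we state the
successor form. [folklore] -/
theorem extend_pow_succ {S : Finset Y} (M : Matrix S S ℂ) (k : ℕ) :
    extend (M ^ (k + 1)) = extend M ^ k * extend M := by
  induction k with
  | zero => simp
  | succ k ih => rw [pow_succ, extend_mul, ih, pow_succ]

omit [Fintype Y] [DecidableEq Y] in
/-- `compress (M + N) S = compress M S + compress N S`. [folklore] -/
theorem compress_add (M N : Matrix Y Y ℂ) (S : Finset Y) : compress (M + N) S = compress M S + compress N S := rfl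

/-! ## §2 The near∕far expansion of a compressed inverse -/

section NearFar

variable {S : Type*} [Fintype S] [DecidableEq S] {κ : ℝ} {d : S → S → ℝ}

/-- **Near∕far expansion to order `p`**: `A_n` invertible, `F` arbitrary, `1 + A_n⁻¹F` invertible ⇒
`(A_n + F)⁻¹ = Σ_{k<p} (−A_n⁻¹F)^k·A_n⁻¹ + (−A_n⁻¹F)^p·(1 + A_n⁻¹F)⁻¹·A_n⁻¹`.  The `k = 0` term `A_n⁻¹` is the NEAR
local inverse; the far kernel enters only through the explicit factors `A_n⁻¹F`. [folklore] -/
theorem inv_near_add_far_eq_sum (An F : Matrix S S ℂ) (hAn : IsUnit An) (hU : IsUnit (1 + An⁻¹ * F)) (p : ℕ) :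
    (An + F)⁻¹ = (∑ k ∈ Finset.range p, (-(An⁻¹ * F)) ^ k * An⁻¹)
      + (-(An⁻¹ * F)) ^ p * (1 + An⁻¹ * F)⁻¹ * An⁻¹ := by
  have h1 : (1 : Matrix S S ℂ) + An⁻¹ * F = 1 - (-(An⁻¹ * F)) := by rw [sub_neg_eq_add]
  have hU' : IsUnit (1 - (-(An⁻¹ * F))) := by rw [← h1]; exact hU
  have hN := inv_one_sub_eq_sum_add (-(An⁻¹ * F)) hU' p
  rw [sub_neg_eq_add] at hN
  calc (An + F)⁻¹ = (1 + An⁻¹ * F)⁻¹ * An⁻¹ := inv_add_eq An F hAn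
    _ = ((∑ k ∈ Finset.range p, (-(An⁻¹ * F)) ^ k) + (-(An⁻¹ * F)) ^ p * (1 + An⁻¹ * F)⁻¹) * An⁻¹ := by
        rw [← hN]
    _ = _ := by rw [add_mul, Finset.sum_mul, Matrix.mul_assoc]

/-- Budget of the order-`k` term: `WRS ((−A_n⁻¹F)^k A_n⁻¹) ≤ (C_nφ)^k·C_n`. [folklore] -/
theorem wrs_nearFar_term (hw : WeightHyp κ d) {An F : Matrix S S ℂ} {Cn φ : ℝ} (hAn : WRS κ d An⁻¹ Cn)
    (hF : WRS κ d F φ) (k : ℕ) : WRS κ d ((-(An⁻¹ * F)) ^ k * An⁻¹) ((Cn * φ) ^ k * Cn) :=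
  ((hAn.mul hw hF).neg.pow hw k).mul hw hAn

/-- Budget of the remainder: `WRS ((−A_n⁻¹F)^p (1 + A_n⁻¹F)⁻¹ A_n⁻¹) ≤ (C_nφ)^p (1 − C_nφ)⁻¹ C_n` when `C_nφ < 1`.
[folklore] -/
theorem wrs_nearFar_remainder (hw : WeightHyp κ d) {An F : Matrix S S ℂ} {Cn φ : ℝ} (hAn : WRS κ d An⁻¹ Cn)
    (hF : WRS κ d F φ) (hsmall : Cn * φ < 1) (p : ℕ) :
    WRS κ d ((-(An⁻¹ * F)) ^ p * (1 + An⁻¹ * F)⁻¹ * An⁻¹) ((Cn * φ) ^ p * (1 - Cn * φ)⁻¹ * Cn) :=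
  (((hAn.mul hw hF).neg.pow hw p).mul hw ((hAn.mul hw hF).inv_one_add hw hsmall)).mul hw hAn

/-- `A_n + F` is invertible when `C_nφ < 1` (`B13PerturbativeStep.isUnit_add` BY NAME). [folklore] -/
theorem isUnit_near_add_far (hw : WeightHyp κ d) {An F : Matrix S S ℂ} {Cn φ : ℝ} (hAnU : IsUnit An)
    (hAn : WRS κ d An⁻¹ Cn) (hF : WRS κ d F φ) (hsmall : Cn * φ < 1) : IsUnit (An + F) :=
  isUnit_add hw hAnU hAn hF hsmall

/-- `1 + A_n⁻¹F` is invertible when `C_nφ < 1`. [folklore] -/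
theorem isUnit_one_add_near_far (hw : WeightHyp κ d) {An F : Matrix S S ℂ} {Cn φ : ℝ}
    (hAn : WRS κ d An⁻¹ Cn) (hF : WRS κ d F φ) (hsmall : Cn * φ < 1) : IsUnit (1 + An⁻¹ * F) :=
  isUnit_one_add hw (hAn.mul hw hF) hsmall

end NearFar

/-! ## §3 The unit-lattice statement for the constructed local inverse -/

omit [Fintype Y] in
/-- **Near∕far splitting of `locInv`**: with `K′ = K_near + K_far`, `A_n := compress (1 + K_near) □̃`,
`F := compress K_far □̃`, and `C_nφ < 1`:
`locInv K′ E b = Σ_{k<p} extend((−A_n⁻¹F)^k A_n⁻¹) + extend((−A_n⁻¹F)^p (1 + A_n⁻¹F)⁻¹ A_n⁻¹)`,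
each extended piece with the budget of §2 (restricted weights) — the leading piece `extend(A_n⁻¹) = locInv K_near E b`
is the local inverse of the NEAR family alone. [folklore] -/
theorem locInv_split {B : Type*} (Knear Kfar : Matrix Y Y ℂ) (E : B → Finset Y) (b : B) {κ : ℝ}
    {d : ↥(E b) → ↥(E b) → ℝ} (hw : WeightHyp κ d) {Cn φ : ℝ}
    (hAnU : IsUnit (compress (1 + Knear) (E b)))
    (hAn : WRS κ d (compress (1 + Knear) (E b))⁻¹ Cn) (hF : WRS κ d (compress Kfar (E b)) φ)
    (hsmall : Cn * φ < 1) (p : ℕ) :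
    locInv (Knear + Kfar) E b
      = (∑ k ∈ Finset.range p,
          extend ((-((compress (1 + Knear) (E b))⁻¹ * compress Kfar (E b))) ^ k * (compress (1 + Knear) (E b))⁻¹))
        + extend ((-((compress (1 + Knear) (E b))⁻¹ * compress Kfar (E b))) ^ p
            * (1 + (compress (1 + Knear) (E b))⁻¹ * compress Kfar (E b))⁻¹ * (compress (1 + Knear) (E b))⁻¹) := by
  rw [locInv, show (1 : Matrix Y Y ℂ) + (Knear + Kfar) = (1 + Knear) + Kfar by abel, compress_add,
    inv_near_add_far_eq_sum _ _ hAnU (isUnit_one_add_near_far hw hAn hF hsmall) p, extend_add]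
  congr 1
  exact extend_sum _ _

omit [Fintype Y] in
/-- The leading piece is the local inverse of the near family: `extend((compress (1 + K_near) □̃)⁻¹) = locInv K_near E b`.
[folklore] -/
theorem extend_inv_near_eq_locInv {B : Type*} (Knear : Matrix Y Y ℂ) (E : B → Finset Y) (b : B) :
    extend ((compress (1 + Knear) (E b))⁻¹) = locInv Knear E b := rfl

end

end Summit.QuantumFields.BalabanUV.Beta.UnitLatticeNearFar
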